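/-
Copyright: cell pub-balaban-gaps (YM BLITZ Y1, track G1), seat g1-p2 GEN 8 (unit `pub-balaban-gaps-g1-p2`).  Row (D4) NODE O,
JUNCTION J-3 (multi-level), THE COVARIANT AVERAGING ON THE NESTED FAMILY: print's operator in Cor. 3.5 is `G(U′)` with the COVARIANT
block averages `Q′_j(U′)` ((3.78) p. 406, (2.13)–(2.14) of [4] with `U′`-parallel transport to the block centre).  With block transporters
posited as fibre matrices `T(u, x′)` (to the centre of the `lev`-block of `x′`) and `T̃(u, x)` (back), the covariant averaging term is
`Σ_j a_j(L^jη)^{−2}L^{−j(d+1)}[x ∼_j x′]·T̃(u,x)T(u,x′)` and its difference from the flat one is, at print's scaling, a CUBE-LOCAL matrix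
`Ã(u)` (row sums `≤ a₊·α_T` under the in-block window `Σ_{b′}‖(1 − T̃(u,x)T(u,x′))_{bb′}‖ ≤ α_T`) times the weight `w² ⊗ 1`,
`w = L^{k−lev}` — the slot of `D4WalkBlockShiftWeightedAv`.  HONEST FRAMING: the flat operator is the lineage's scalar model; transporters
and defects are hypothesis SHAPES (Bałaban's contours `Γ_{y,x}` and `U′ = e^{iηA}` NOT constructed); (D4) NOT discharged (instance 0∕1);
NOT BetaPertH, NOT continuum, NOT Clay.
-/
import Summits.QuantumFields.BalabanUV.Gaps.D4WalkBlockCovariantWeightedMultiLevel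
import Summits.QuantumFields.BalabanUV.Gaps.D4WalkBlockShiftWeightedAv

/-!
# `Gaps.D4WalkBlockCovariantAveragingMultiLevel` — Cor. 3.5's step WITH THE COVARIANT AVERAGING `Q′_j(U′)` on [4]'s nested family,
# under print's level-dependent windows (cell pub-balaban-gaps, seat g1-p2 gen 8)

HONEST DEPENDENCY (cell pub-balaban, verbatim): continuum YM on T⁴ ⇐ BetaPertH ∧ nine spine estimates (0/9 proved);
BetaPertH ⇐ (D1) ∧ (D4) ∧ CAP+tail.

* §1 **`cubeML_eq_of_blk_eq`** (a `L^j`-block, `j ≤ k`, lies in one top cube); `card_filter_blk_le`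
  (a `b`-block meets the fundamental box in `≤ b^{d+1}` sites);
* §2 **`covAvgOp`** (the covariant multi-level averaging form `Σ_j levC_j[x ∼_j x′]T̃(u,x)T(u,x′)`, lattice units, fibred),
  **`avCorr`** (`Ã(u)_{(x,b),(x′,b′)} = [x′ ∼_{lev x} x]·a_{lev x}L^{−lev x·(d+1)}·(1 − T̃(u,x)T(u,x′))_{bb′}`): `avCorr_local` (cube-local),
  **`avCorr_rowSum_le`** (`Σ_q‖Ã(u)_{pq}‖ ≤ a₊·α_T`), `avCorr_holo`, and the FAITHFULNESS identity **`avCorr_mul_wOp`**: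
  `Ã(u)·(w² ⊗ 1) = (L^{2k}·(Δ′_a − (−Δ^{per}))) ⊗ 1 − L^{2k}·covAvgOp(u)` (`η⁻²`·(flat averaging form) minus `η⁻²`·(covariant one));
* §3 **`blockWalkExpansion_covAvg_multiLevelTorus`** — COR. 3.5's STEP FOR `V_W + Ã·(w² ⊗ 1)` on the genuine multi-level flat
  propagator `η²G′ ⊗ 1` under the LEVEL-DEPENDENT windows (bond `αL^{−lev x}`, divergence `α′L^{−2lev x}`) and the in-block transport
  window `α_T`: margin `c_μ(c_μ·1·(1·((0 + Σ_j covAlphaW α (α′ + a₊α_T) j·covBW δ₁ L j)C))c_μ)c_μ < 1`, letters `covBW δ₁ L`, constants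
  functions of `(d, ℓ, weight windows)` — uniform in `k`, the torus, `{Ω_j}`, the fibre;
* §4 **`covariantAvg_kernel_eq_multiLevel`** — WHAT IT EXPANDS: given invertibility,
  `(W ⊗ 1)(1 − (V_W + Ã(w² ⊗ 1) + V_x)(W ⊗ 1))⁻¹ = (Δ_W + L^{2k}·covAvgOp(u) − V_x)⁻¹` — the covariant Laplacian PLUS THE COVARIANT
  MULTI-LEVEL AVERAGING FORM, in print units, inverted (76's identity + §2's faithfulness).
WHAT IT IS NOT.  Bałaban's contours and `U(Γ_{y,x})` from a bond field (65∕66 are one-scale); the windows FROM (3.35)–(3.36); (D4) 0∕1.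

References: T. Bałaban, Comm. Math. Phys. **99** (1985) 389–434 [B9], (3.37) p. 396, (3.42) p. 397, (3.61)–(3.64) p. 402, (3.78)
p. 406, Cor. 3.5 p. 407; Comm. Math. Phys. **96** (1984) [4], (2.13)–(2.14) p. 225, Prop. 2.2 (2.67) p. 234.
-/

noncomputable section

namespace Summit.QuantumFields.BalabanUV.Gaps.D4WalkBlockCovariantAveragingMultiLevel

open Metric
open scoped Matrix
open Literature.MathematicalPhysics.QuantumFieldTheory.Balaban1983to89
open Literature.MathematicalPhysics.QuantumFieldTheory.Balaban1983to89.B4Reflection242 (boxDom mem_boxDom blk avgK)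
open Literature.MathematicalPhysics.QuantumFieldTheory.Balaban1983to89.B4Thm110ZeroBox (blk_blk)
open Literature.MathematicalPhysics.QuantumFieldTheory.Balaban1983to89.B9SectDWalk (DomBy)
open Literature.MathematicalPhysics.QuantumFieldTheory.Balaban1983to89.B9Thm34Ext (toB6)
open Literature.MathematicalPhysics.QuantumFieldTheory.Balaban1983to89.B9Thm37GlueTorus (torusGeom tdist1)
open Literature.MathematicalPhysics.QuantumFieldTheory.Balaban1983to89.TreeLengthTorus (TPt)
open Literature.MathematicalPhysics.QuantumFieldTheory.Balaban1983to89.B5TorusCover (UT)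
open Literature.MathematicalPhysics.QuantumFieldTheory.Balaban1983to89.B11SectG (RowSum)
open Literature.MathematicalPhysics.QuantumFieldTheory.Balaban1983to89.B6MultiLevelBoxOperator (N0 levC)
open Literature.MathematicalPhysics.QuantumFieldTheory.Balaban1983to89.B6MultiLevelTorusOperator (TDomains gmlT mlOpT perLapT tshift
  unitVec mlOpT_apply)
open Literature.MathematicalPhysics.QuantumFieldTheory.Balaban1983to89.B6Ineq243TwoLevelBox (aNext)
open Summit.QuantumFields.BalabanUV.Gaps.D4WalkBlock (blockNorm BlockWalkExpansion)
open Summit.QuantumFields.BalabanUV.Gaps.D4WalkProduct (differentiableOn_mul_entry)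
open Summit.QuantumFields.BalabanUV.Gaps.D4WalkBlockMultiLevelGeometry (cubeOfLabel cubeML)
open Summit.QuantumFields.BalabanUV.Gaps.D4WalkBlockShiftAlgebra (fibD covShift)
open Summit.QuantumFields.BalabanUV.Gaps.D4WalkBlockShiftStep (covLap)
open Summit.QuantumFields.BalabanUV.Gaps.D4WalkBlockShiftWeighted (wOp covDopW covBW covAlphaW)
open Summit.QuantumFields.BalabanUV.Gaps.D4WalkBlockShiftWeightedAv (mul_wOp_apply blockWalkExpansion_covShiftWAv_of_letters)
open Summit.QuantumFields.BalabanUV.Gaps.D4WalkBlockCovariantShiftMultiLevel (tdist1_cubeML_tshift_symm_unitVec_le_one)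
open Summit.QuantumFields.BalabanUV.Gaps.D4WalkBlockCovariantKernelMultiLevel (covariant_kernel_eq_multiLevel)
open Summit.QuantumFields.BalabanUV.Gaps.D4WalkBlockWeightedLettersMultiLevel (levW levW_pos levW_le_mul_tshift_symm
  weightedLetters_multiLevelTorus)

variable {d : ℕ}

/-! ## §1. Blocks nest in top cubes; a block has `≤ b^{d+1}` sites in the box -/

section Geometry

variable {ℓ k : ℕ} {Kc : Fin (d + 1) → ℕ} [∀ i, NeZero (Kc i)]

omit [∀ i, NeZero (Kc i)] in
/-- **A level-`j` block (`j ≤ k`) lies in ONE top cube**: `blk_{L^j} x′ = blk_{L^j} x ⟹ cubeML x′ = cubeML x`.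
[cite: Balaban1984PropagatorsII, (2.1) p.224 (nested blocks)] -/
theorem cubeML_eq_of_blk_eq [∀ i, NeZero (Kc i)] {j : ℕ} (hj : j ≤ k) {x x' : Fin (d + 1) → ℤ}
    (h : blk ((ℓ + 1) ^ j) x' = blk ((ℓ + 1) ^ j) x) : cubeML ℓ k Kc x' = cubeML ℓ k Kc x := by
  have e : (ℓ + 1) ^ k = (ℓ + 1) ^ j * (ℓ + 1) ^ (k - j) := by rw [← pow_add, Nat.add_sub_cancel' hj]
  unfold cubeML
  rw [e, ← blk_blk, ← blk_blk, h]

/-- **A `b`-block meets the fundamental box in at most `b^{d+1}` sites.** [folklore] -/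
theorem card_filter_blk_le {N : Fin (d + 1) → ℕ} {b : ℕ} (hb : 1 ≤ b) (x : ↥(boxDom N)) :
    (Finset.univ.filter fun x' : ↥(boxDom N) => blk b x'.1 = blk b x.1).card ≤ b ^ (d + 1) := by
  have h2 : (B4Reflection242.blockOf b x.1).card = b ^ (d + 1) := by
    unfold B4Reflection242.blockOf
    rw [Fintype.card_piFinset]
    simp only [Int.card_Ico, add_sub_cancel_left, Int.toNat_natCast, Finset.prod_const, Finset.card_univ, Fintype.card_fin]
  rw [← h2]
  refine Finset.card_le_card_of_injOn (fun x' : ↥(boxDom N) => x'.1) ?_ ?_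
  · intro x' hx'
    have hx'' : blk b x'.1 = blk b x.1 := by simpa using hx'
    simpa using (B4Reflection242.mem_blockOf hb).2 hx''
  · intro x₁ _ x₂ _ h
    exact Subtype.ext h

end Geometry

/-! ## §2. The covariant averaging form, the correction `Ã`, and faithfulness -/

section Averaging

variable {ℓ Mh k R : ℕ} {P : Fin (d + 1) → ℕ} (D : TDomains d ℓ Mh k P R) (a : ℕ → ℝ)
variable {F : Type} [Fintype F] [DecidableEq F] {E : Type*} [NormedAddCommGroup E] [NormedSpace ℂ E]
variable (Tg Tgi : E → ↥(boxDom (N0 ℓ Mh k P)) → Matrix F F ℂ)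

/-- **THE COVARIANT MULTI-LEVEL AVERAGING FORM** `Σ_j levC_j·[x′ ∼_j x]·T̃(u,x)T(u,x′)` (lattice units, fibred): the term
`Σ_j a_j(L^jη)^{d−2}|Q′_j(U′)λ|²` of the covariant (2.13)–(2.14) with the block transporters `U(Γ_{y,x})` POSITED as the fibre matrices
`T(u,x′)` (to the centre), `T̃(u,x)` (back). [cite: Balaban1984PropagatorsII, (2.13)–(2.14) p.225; Balaban1985BackgroundPropagators, (3.78) p.406] -/
def covAvgOp (u : E) : Matrix (↥(boxDom (N0 ℓ Mh k P)) × F) (↥(boxDom (N0 ℓ Mh k P)) × F) ℂ :=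
  Matrix.of fun p q =>
    if blk ((ℓ + 1) ^ D.lev p.1.1) q.1.1 = blk ((ℓ + 1) ^ D.lev p.1.1) p.1.1 then
      ((levC d ℓ a (D.lev p.1.1) : ℝ) : ℂ) * (Tgi u p.1 * Tg u q.1) p.2 q.2
    else 0

/-- **THE COVARIANT-AVERAGING CORRECTION** `Ã(u)_{(x,b),(x′,b′)} = [x′ ∼_{lev x} x]·a_{lev x}L^{−lev x·(d+1)}·(1 − T̃(u,x)T(u,x′))_{bb′}`:
`Ã(u)·(w² ⊗ 1)` is `η⁻²`·(flat − covariant averaging form) (`avCorr_mul_wOp`). [cite: Balaban1985BackgroundPropagators, (3.78) p.406, (3.61) p.402] -/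
def avCorr (u : E) : Matrix (↥(boxDom (N0 ℓ Mh k P)) × F) (↥(boxDom (N0 ℓ Mh k P)) × F) ℂ :=
  Matrix.of fun p q =>
    if blk ((ℓ + 1) ^ D.lev p.1.1) q.1.1 = blk ((ℓ + 1) ^ D.lev p.1.1) p.1.1 then
      ((a (D.lev p.1.1) * ((((ℓ : ℝ) + 1) ^ D.lev p.1.1) ^ (d + 1))⁻¹ : ℝ) : ℂ) * (1 - Tgi u p.1 * Tg u q.1) p.2 q.2
    else 0

variable {D a Tg Tgi}

omit [Fintype F] [DecidableEq F] [NormedAddCommGroup E] [NormedSpace ℂ E] in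
/-- `Ã(u)` is CUBE-LOCAL for the top cubes (its support is inside the `lev`-blocks, which nest in top cubes). -/
theorem avCorr_local [Fintype F] [DecidableEq F] {Kc : Fin (d + 1) → ℕ} [∀ i, NeZero (Kc i)] (u : E)
    (p q : ↥(boxDom (N0 ℓ Mh k P)) × F) (h : avCorr D a Tg Tgi u p q ≠ 0) :
    cubeML ℓ k Kc p.1.1 = cubeML ℓ k Kc q.1.1 := by
  unfold avCorr at h
  rw [Matrix.of_apply] at h
  by_cases hb : blk ((ℓ + 1) ^ D.lev p.1.1) q.1.1 = blk ((ℓ + 1) ^ D.lev p.1.1) p.1.1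
  · exact (cubeML_eq_of_blk_eq (D.lev_le _) hb).symm
  · exact absurd (if_neg hb) h

omit [NormedSpace ℂ E] in
/-- **ROW SUMS OF `Ã`**: under the in-block transport window `Σ_{b′}‖(1 − T̃(u,x)T(u,x′))_{bb′}‖ ≤ α_T` (`x′ ∼_{lev x} x`) and weights
`0 ≤ a_j ≤ a₊` (`j ≥ 1`): `Σ_q‖Ã(u)_{pq}‖ ≤ a₊·α_T` — the `L^{lev·(d+1)}` sites of the block against `L^{−lev·(d+1)}`.
[cite: Balaban1985BackgroundPropagators, (3.37) p.396, (3.78) p.406] -/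
theorem avCorr_rowSum_le {aplus αT Rb : ℝ} (haw : ∀ i, 1 ≤ i → 0 ≤ a i ∧ a i ≤ aplus) (hαT : 0 ≤ αT)
    (hT : ∀ u ∈ ball (0 : E) Rb, ∀ x x' : ↥(boxDom (N0 ℓ Mh k P)),
      blk ((ℓ + 1) ^ D.lev x.1) x'.1 = blk ((ℓ + 1) ^ D.lev x.1) x.1 → ∀ b, ∑ b', ‖(1 - Tgi u x * Tg u x') b b'‖ ≤ αT) :
    ∀ u ∈ ball (0 : E) Rb, ∀ p, ∑ q, ‖avCorr D a Tg Tgi u p q‖ ≤ aplus * αT := by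
  intro u hu p
  obtain ⟨ha0, hale⟩ := haw (D.lev p.1.1) (D.one_le_lev _)
  have hL0 : (0 : ℝ) < (ℓ : ℝ) + 1 := by positivity
  set c : ℝ := a (D.lev p.1.1) * ((((ℓ : ℝ) + 1) ^ D.lev p.1.1) ^ (d + 1))⁻¹ with hc
  have hc0 : 0 ≤ c := by positivity
  have hterm : ∀ x' : ↥(boxDom (N0 ℓ Mh k P)), ∑ b', ‖avCorr D a Tg Tgi u p (x', b')‖ ≤
      if blk ((ℓ + 1) ^ D.lev p.1.1) x'.1 = blk ((ℓ + 1) ^ D.lev p.1.1) p.1.1 then c * αT else 0 := by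
    intro x'
    by_cases h : blk ((ℓ + 1) ^ D.lev p.1.1) x'.1 = blk ((ℓ + 1) ^ D.lev p.1.1) p.1.1
    · rw [if_pos h]
      have e : ∀ b', ‖avCorr D a Tg Tgi u p (x', b')‖ = c * ‖(1 - Tgi u p.1 * Tg u x') p.2 b'‖ := by
        intro b'
        unfold avCorr
        rw [Matrix.of_apply, if_pos h, norm_mul, Complex.norm_real, Real.norm_eq_abs, abs_of_nonneg hc0]
      rw [Finset.sum_congr rfl fun b' _ => e b', ← Finset.mul_sum]
      exact mul_le_mul_of_nonneg_left (hT u hu p.1 x' h p.2) hc0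
    · rw [if_neg h]
      refine (Finset.sum_eq_zero fun b' _ => ?_).le
      unfold avCorr
      rw [Matrix.of_apply, if_neg h, norm_zero]
  rw [Fintype.sum_prod_type]
  refine (Finset.sum_le_sum fun x' _ => hterm x').trans ?_
  rw [← Finset.sum_filter, Finset.sum_const, nsmul_eq_mul]
  have hcard := card_filter_blk_le (N := N0 ℓ Mh k P) (b := (ℓ + 1) ^ D.lev p.1.1) (Nat.one_le_pow _ _ (by omega)) p.1
  have hcardR : ((Finset.univ.filter fun x' : ↥(boxDom (N0 ℓ Mh k P)) =>
      blk ((ℓ + 1) ^ D.lev p.1.1) x'.1 = blk ((ℓ + 1) ^ D.lev p.1.1) p.1.1).card : ℝ) ≤ (((ℓ : ℝ) + 1) ^ D.lev p.1.1) ^ (d + 1) := by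
    exact_mod_cast hcard
  have hpow : ((((ℓ : ℝ) + 1) ^ D.lev p.1.1) ^ (d + 1)) ≠ 0 := by positivity
  calc _ ≤ (((ℓ : ℝ) + 1) ^ D.lev p.1.1) ^ (d + 1) * (c * αT) := mul_le_mul_of_nonneg_right hcardR (by positivity)
    _ = a (D.lev p.1.1) * αT := by rw [hc]; field_simp
    _ ≤ aplus * αT := mul_le_mul_of_nonneg_right hale hαT

/-- `Ã(u)` is entrywise holomorphic when the transporters are. -/
theorem avCorr_holo {Rb : ℝ} (hTg : ∀ x b b', DifferentiableOn ℂ (fun u => Tg u x b b') (ball (0 : E) Rb))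
    (hTgi : ∀ x b b', DifferentiableOn ℂ (fun u => Tgi u x b b') (ball (0 : E) Rb)) :
    ∀ p q, DifferentiableOn ℂ (fun u => avCorr D a Tg Tgi u p q) (ball (0 : E) Rb) := by
  intro p q
  by_cases h : blk ((ℓ + 1) ^ D.lev p.1.1) q.1.1 = blk ((ℓ + 1) ^ D.lev p.1.1) p.1.1
  · have e : (fun u => avCorr D a Tg Tgi u p q) = fun u =>
        ((a (D.lev p.1.1) * ((((ℓ : ℝ) + 1) ^ D.lev p.1.1) ^ (d + 1))⁻¹ : ℝ) : ℂ) *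
          ((1 : Matrix F F ℂ) p.2 q.2 - (Tgi u p.1 * Tg u q.1) p.2 q.2) := by
      funext u; unfold avCorr; rw [Matrix.of_apply, if_pos h, Matrix.sub_apply]
    rw [e]
    exact (differentiableOn_const _).mul ((differentiableOn_const _).sub
      (differentiableOn_mul_entry (M₁ := fun u => Tgi u p.1) (M₂ := fun u => Tg u q.1) (hTgi p.1) (hTg q.1) p.2 q.2))
  · have e : (fun u => avCorr D a Tg Tgi u p q) = fun _ => 0 := by
      funext u; unfold avCorr; rw [Matrix.of_apply, if_neg h]
    rw [e]; exact differentiableOn_const _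

omit [NormedAddCommGroup E] [NormedSpace ℂ E] in
/-- **FAITHFULNESS**: `Ã(u)·(w² ⊗ 1) = (L^{2k}·(Δ′_a − (−Δ^{per}))) ⊗ 1 − L^{2k}·covAvgOp(u)` (`w = L^{k−lev}`, `η⁻² = L^{2k}`): the
weighted correction IS `η⁻²`·(flat averaging form ⊗ 1_F) minus `η⁻²`·(covariant averaging form).
[cite: Balaban1984PropagatorsII, (2.13)–(2.14) p.225; Balaban1985BackgroundPropagators, (3.78) p.406] -/
theorem avCorr_mul_wOp (u : E) :
    avCorr D a Tg Tgi u * wOp ↥(boxDom (N0 ℓ Mh k P)) F (fun x => levW D x ^ 2) =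
      Matrix.blockDiagonal (fun _ : F => (((ℓ : ℂ) + 1) ^ (2 * k) : ℂ) •
          (mlOpT (N0 ℓ Mh k P) ℓ k D.lev a - perLapT (N0 ℓ Mh k P)).map ((↑) : ℝ → ℂ)) -
        (((ℓ : ℂ) + 1) ^ (2 * k) : ℂ) • covAvgOp D a Tg Tgi u := by
  ext p q
  rcases p with ⟨x, b⟩
  rcases q with ⟨x', b'⟩
  rw [mul_wOp_apply, Matrix.sub_apply, Matrix.blockDiagonal_apply, Matrix.smul_apply, smul_eq_mul]
  have hflat : (mlOpT (N0 ℓ Mh k P) ℓ k D.lev a - perLapT (N0 ℓ Mh k P)) x x' =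
      avgK (levC d ℓ a (D.lev x.1)) ((ℓ + 1) ^ D.lev x.1) x.1 x'.1 := by
    rw [Matrix.sub_apply, mlOpT_apply D rfl a x x']; ring
  unfold avCorr covAvgOp
  simp only [Matrix.of_apply, Matrix.smul_apply, Matrix.map_apply, smul_eq_mul, hflat]
  unfold avgK
  by_cases h : blk ((ℓ + 1) ^ D.lev x.1) x'.1 = blk ((ℓ + 1) ^ D.lev x.1) x.1
  · rw [if_pos h, if_pos h, if_pos h]
    have hlev : D.lev x'.1 = D.lev x.1 := D.lev_eq_of_blk_eq x.2 x'.2 h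
    have hj : D.lev x.1 ≤ k := D.lev_le _
    have hL : ((ℓ : ℝ) + 1) ≠ 0 := by positivity
    -- the scalar identity `a_jL^{−j(d+1)}·(L^{k−j})² = L^{2k}·levC_j`
    have hsc : ((a (D.lev x.1) * ((((ℓ : ℝ) + 1) ^ D.lev x.1) ^ (d + 1))⁻¹ : ℝ) : ℂ) * (((levW D x' ^ 2 : ℝ)) : ℂ) =
        (((ℓ : ℂ) + 1) ^ (2 * k) : ℂ) * ((levC d ℓ a (D.lev x.1) : ℝ) : ℂ) := by
      have hLc : ((ℓ : ℂ) + 1) ≠ 0 := by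
        have : (0 : ℝ) < (ℓ : ℝ) + 1 := by positivity
        exact_mod_cast this.ne'
      have e2 : (((ℓ : ℂ) + 1) ^ (k - D.lev x.1)) ^ 2 * (((ℓ : ℂ) + 1) ^ D.lev x.1) ^ 2 = ((ℓ : ℂ) + 1) ^ (2 * k) := by
        rw [← mul_pow, ← pow_add, Nat.sub_add_cancel hj, ← pow_mul, mul_comm]
      unfold levW levC
      rw [hlev]
      push_cast
      rw [← e2]
      field_simp
    rw [Matrix.sub_apply, Matrix.one_apply, mul_sub, sub_mul]
    congr 1
    · by_cases hbb : b = b'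
      · subst hbb
        rw [if_pos rfl, if_pos rfl, mul_one, hsc]
      · rw [if_neg hbb, if_neg hbb, mul_zero, zero_mul]
    · rw [mul_right_comm, hsc, mul_assoc]
  · rw [if_neg h, if_neg h, if_neg h, zero_mul, mul_zero]
    push_cast
    rw [mul_zero]
    simp

end Averaging

/-! ## §3. Cor. 3.5's step with the covariant averaging on the nested family -/

section Step

variable {dd N' : ℕ} {E : Type*} [NormedAddCommGroup E] [NormedSpace ℂ E]

/-- **[B9] COR. 3.5's STEP WITH THE COVARIANT AVERAGING ON THE GENUINE NESTED FAMILY, UNDER PRINT'S LEVEL-DEPENDENT WINDOWS.**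
There are `δ₁, C, M₀ > 0`, `N₀ ≥ 1` (functions of `d, ℓ`, weight windows) such that for every admissible `(k, M_h, R, P, D, a, c, Kc)`, every
finite fibre, every holomorphic defect family with the LEVEL-DEPENDENT windows (bond `L^{−k}α·w(x) = αL^{−lev x}`, divergence
`α′L^{−2lev x}`), every holomorphic family of block transporters `T, T̃` with the in-block window `Σ_{b′}‖(1 − T̃(u,x)T(u,x′))_{bb′}‖ ≤ α_T`
(`x′ ∼_{lev x} x`), every cube row sum `(μ, c_μ)`, `2μ ≤ ε`, `2μ ≤ δ₁ − ε − μ`, margin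
`c_μ(c_μ·1·(1·((0 + Σ_j covAlphaW α (α′ + a₊α_T) j·covBW δ₁ L j)C))c_μ)c_μ < 1`:
`(W ⊗ 1)(1 − (V_W(u) + Ã(u)(w² ⊗ 1))(W ⊗ 1))⁻¹` is a block walk expansion at `(ε − 2μ, δ₁ − ε − 3μ, c_μC(1·(1−q)⁻¹)c_μ, δ₁ − 2μ)` with
the relative letters `covBW δ₁ L`, dominating distances — by §4 it expands `(Δ_W + L^{2k}covAvgOp(u))⁻¹`, the covariant multi-level operator.
[cite: Balaban1985BackgroundPropagators, Cor. 3.5 p.407, (3.78) p.406, (3.37) p.396, (3.42) p.397, (3.61) p.402; Balaban1984PropagatorsII, (2.13)–(2.14) p.225, Prop. 2.2 (2.67) p.234; Balaban1988RG2Cluster, (1.11) p.5] -/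
theorem blockWalkExpansion_covAvg_multiLevelTorus (d ℓ : ℕ) (hℓ : 1 ≤ ℓ) (aminus aplus a2minus a2plus : ℝ)
    (ha : 0 < aminus) (ha2 : 0 < a2minus) :
    ∃ δ₁ C M₀ : ℝ, ∃ N₀ : ℕ, 0 < δ₁ ∧ 0 < C ∧ 0 < M₀ ∧ 0 < N₀ ∧
      ∀ (k Mh R : ℕ), 3 ≤ Mh → M₀ ≤ ((ℓ : ℝ) + 1) * Mh → 2 * (ℓ + 1) ≤ R → N₀ + 1 ≤ R * ((ℓ + 1) * Mh) →
      ∀ (P : Fin (d + 1) → ℕ) (hP : ∀ μ, 1 ≤ P μ) (hP4 : ∀ μ, 4 ≤ P μ) (D : TDomains d ℓ Mh k P R) (a c : ℕ → ℝ),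
        (∀ i, 1 ≤ i → aminus ≤ a i ∧ a i ≤ aplus) → (∀ i, 1 ≤ i → a2minus ≤ c i ∧ c i ≤ a2plus) →
        (∀ i, 1 ≤ i → a (i + 1) = aNext ℓ (a i) (c i)) →
      ∀ (Kc : Fin (d + 1) → ℕ) [∀ i, NeZero (Kc i)], (∀ i, N0 ℓ Mh k P i = (ℓ + 1) ^ k * Kc i) →
      ∀ (F : Type) [Fintype F] [DecidableEq F] (c₀ : B13.Consts) (Xs : Finset (UT Kc)) (Rb : ℝ)
        (Wp Wm : Fin (d + 1) → E → ↥(boxDom (N0 ℓ Mh k P)) → Matrix F F ℂ)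
        (Tg Tgi : E → ↥(boxDom (N0 ℓ Mh k P)) → Matrix F F ℂ) (α α' αT ε μ cμ : ℝ),
      (∀ ν x a' b, DifferentiableOn ℂ (fun u => Wp ν u x a' b) (ball (0 : E) Rb)) →
      (∀ ν x a' b, DifferentiableOn ℂ (fun u => Wm ν u x a' b) (ball (0 : E) Rb)) →
      (∀ x b b', DifferentiableOn ℂ (fun u => Tg u x b b') (ball (0 : E) Rb)) →
      (∀ x b b', DifferentiableOn ℂ (fun u => Tgi u x b b') (ball (0 : E) Rb)) →
      0 ≤ α → 0 ≤ α' → 0 ≤ αT →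
      (∀ ν, ∀ u ∈ ball (0 : E) Rb, ∀ x a', ∑ b, ‖Wp ν u x a' b‖ ≤ (((ℓ : ℝ) + 1) ^ k)⁻¹ * α * levW D x) →
      (∀ ν, ∀ u ∈ ball (0 : E) Rb, ∀ x a', ∑ b, ‖Wm ν u x a' b‖ ≤ (((ℓ : ℝ) + 1) ^ k)⁻¹ * α * levW D x) →
      (∀ u ∈ ball (0 : E) Rb, ∀ x a', ∑ b, ‖(∑ ν, (Wp ν u x + Wm ν u x)) a' b‖ ≤ ((((ℓ : ℝ) + 1) ^ k)⁻¹) ^ 2 * α' * levW D x ^ 2) →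
      (∀ u ∈ ball (0 : E) Rb, ∀ x x' : ↥(boxDom (N0 ℓ Mh k P)),
        blk ((ℓ + 1) ^ D.lev x.1) x'.1 = blk ((ℓ + 1) ^ D.lev x.1) x.1 → ∀ b, ∑ b', ‖(1 - Tgi u x * Tg u x') b b'‖ ≤ αT) →
      0 ≤ μ → 2 * μ ≤ ε → 2 * μ ≤ δ₁ - ε - μ → 0 ≤ cμ →
      RowSum (toB6 (torusGeom Kc 0 0 0) 0 True) μ cμ →
      cμ * (cμ * 1 * (1 * ((0 + ∑ j : Unit ⊕ (Fin (d + 1) ⊕ Fin (d + 1)),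
        covAlphaW α (α' + aplus * αT) j * covBW δ₁ ((ℓ : ℝ) + 1) j) * C)) * cμ) * cμ < 1 →
      ∃ (W : Type) (T : W → (TPt dd N' → ℂ) → E → Matrix (↥(boxDom (N0 ℓ Mh k P)) × F) (↥(boxDom (N0 ℓ Mh k P)) × F) ℂ)
        (SX' : Set W) (A' : W → ℝ) (D' : W → UT Kc → UT Kc → ℝ),
        BlockWalkExpansion c₀ (fun q : ↥(boxDom (N0 ℓ Mh k P)) × F => cubeML ℓ k Kc q.1.1)
          (fun q : ↥(boxDom (N0 ℓ Mh k P)) × F => cubeML ℓ k Kc q.1.1)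
          (fun (_ : TPt dd N' → ℂ) u =>
            Matrix.blockDiagonal (fun _ : F =>
                ((((ℓ : ℂ) + 1) ^ (2 * k))⁻¹ : ℂ) • (gmlT (N0 ℓ Mh k P) ℓ k D.lev a).map ((↑) : ℝ → ℂ)) *
              (1 - (covShift ↥(boxDom (N0 ℓ Mh k P)) F (fun ν => tshift (N0 ℓ Mh k P) (unitVec ν))
                    ((((ℓ : ℝ) + 1) ^ k)⁻¹) Wp Wm u +
                  avCorr D a Tg Tgi u * wOp ↥(boxDom (N0 ℓ Mh k P)) F (fun x => levW D x ^ 2)) *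
                Matrix.blockDiagonal (fun _ : F =>
                  ((((ℓ : ℂ) + 1) ^ (2 * k))⁻¹ : ℂ) • (gmlT (N0 ℓ Mh k P) ℓ k D.lev a).map ((↑) : ℝ → ℂ)))⁻¹)
          Xs Rb (ε - 2 * μ) (δ₁ - ε - μ - 2 * μ)
          (cμ * C * (1 * (1 - cμ * (cμ * 1 * (1 * ((0 + ∑ j : Unit ⊕ (Fin (d + 1) ⊕ Fin (d + 1)),
            covAlphaW α (α' + aplus * αT) j * covBW δ₁ ((ℓ : ℝ) + 1) j) * C)) * cμ) * cμ)⁻¹) * cμ)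
          T SX' A' D' (δ₁ - 2 * μ) ∧
        (∀ (j : Unit ⊕ (Fin (d + 1) ⊕ Fin (d + 1))) ω (σ : TPt dd N' → ℂ), (∀ i, ‖σ i‖ ≤ Real.exp c₀.κ₁) →
          ∀ u ∈ ball (0 : E) Rb, ∀ Y Y',
          blockNorm (fun q : ↥(boxDom (N0 ℓ Mh k P)) × F => cubeML ℓ k Kc q.1.1)
              (fun q : ↥(boxDom (N0 ℓ Mh k P)) × F => cubeML ℓ k Kc q.1.1)
              (covDopW ↥(boxDom (N0 ℓ Mh k P)) F (fun ν => tshift (N0 ℓ Mh k P) (unitVec ν)) ((((ℓ : ℝ) + 1) ^ k)⁻¹) (levW D) j *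
                T ω σ u) Y Y' ≤
            covBW (ι := Fin (d + 1)) δ₁ ((ℓ : ℝ) + 1) j * (A' ω * Real.exp (-((δ₁ - 2 * μ) * D' ω Y Y')))) ∧
        ∀ ω, DomBy (toB6 (torusGeom Kc 0 0 0) 0 True) (D' ω) := by
  obtain ⟨δ₁, C, M₀, N₀, hδ₁, hC, hM₀, hN₀, hlet⟩ := weightedLetters_multiLevelTorus d ℓ hℓ aminus aplus a2minus a2plus ha ha2
  refine ⟨δ₁, C, M₀, N₀, hδ₁, hC, hM₀, hN₀, ?_⟩
  intro k Mh R hMh hM hR hRM P hP hP4 D a c haw hcw hac Kc _ hKc F _ _ c₀ Xs Rb Wp Wm Tg Tgi α α' αT ε μ cμ hWph hWmh hTgh hTgih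
    hα hα' hαT hWp hWm hdiv hT hμ hμε hμκ hcμ hrow hq
  have hl := hlet k Mh R hMh hM hR hRM P hP hP4 D a c haw hcw hac Kc hKc F
  have hMh1 : 1 ≤ Mh := le_trans (by norm_num) hMh
  have hR1 : 1 ≤ R := le_trans (by omega) hR
  have hη : (0 : ℝ) < (((ℓ : ℝ) + 1) ^ k)⁻¹ := by positivity
  have hL0 : (0 : ℝ) ≤ (ℓ : ℝ) + 1 := by positivity
  have haplus : 0 ≤ aplus := by obtain ⟨h1, h2⟩ := haw 1 le_rfl; linarith
  have haw0 : ∀ i, 1 ≤ i → 0 ≤ a i ∧ a i ≤ aplus := fun i hi => ⟨by obtain ⟨h1, _⟩ := haw i hi; linarith, (haw i hi).2⟩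
  have hsh : ∀ ν (x : ↥(boxDom (N0 ℓ Mh k P))), tdist1 Kc ((fun x : ↥(boxDom (N0 ℓ Mh k P)) => cubeML ℓ k Kc x.1)
      ((tshift (N0 ℓ Mh k P) (unitVec ν)).symm x)) ((fun x : ↥(boxDom (N0 ℓ Mh k P)) => cubeML ℓ k Kc x.1) x) ≤ 1 :=
    fun ν x => tdist1_cubeML_tshift_symm_unitVec_le_one hKc ν x
  have hwr : ∀ ν (x : ↥(boxDom (N0 ℓ Mh k P))), levW D x ≤ ((ℓ : ℝ) + 1) * levW D ((tshift (N0 ℓ Mh k P) (unitVec ν)).symm x) :=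
    fun ν x => levW_le_mul_tshift_symm (D := D) hR1 hMh1 ν x
  exact blockWalkExpansion_covShiftWAv_of_letters (X := ↥(boxDom (N0 ℓ Mh k P))) (F := F) (E := E) (dd := dd) (N' := N')
    (sh := fun ν => tshift (N0 ℓ Mh k P) (unitVec ν)) (η := (((ℓ : ℝ) + 1) ^ k)⁻¹) (w := levW D)
    (fun x : ↥(boxDom (N0 ℓ Mh k P)) => cubeML ℓ k Kc x.1) hη (fun x => levW_pos (D := D) x) hL0 hsh hwr _ hC.le hδ₁.le
    (fun Y Y' => (hl Y Y').1) (fun Y Y' => (hl Y Y').2.1) (fun ν Y Y' => (hl Y Y').2.2 ν) c₀ Xs Rb Wp Wm (avCorr D a Tg Tgi)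
    α α' (aplus * αT) ε μ cμ hWph hWmh (avCorr_holo hTgh hTgih) hα hα' (by positivity) hWp hWm hdiv
    (fun u p q h => avCorr_local (Kc := Kc) u p q h) (avCorr_rowSum_le haw0 hαT hT) hμ hμε hμκ hcμ hrow hq

end Step

/-! ## §4. What it expands: the covariant Laplacian plus the covariant multi-level averaging form -/

section Kernel

variable {ℓ Mh k R : ℕ} {P : Fin (d + 1) → ℕ} {F : Type} [Fintype F] [DecidableEq F]
variable {E : Type*} [NormedAddCommGroup E] [NormedSpace ℂ E]

omit [NormedAddCommGroup E] [NormedSpace ℂ E] in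
/-- **THE KERNEL IDENTITY WITH THE COVARIANT AVERAGING** ([B9] (3.62)∕(3.64), (3.78)): for a nested family `D` (`M_h, P ≥ 1`), weights
positive at levels `≥ 1`, `W = η²(G′.map ofReal)`, `η = L^{−k}`, defects `W^±`, transporters `T, T̃`, and any further slot `V_x`: IF
`1 − (V_W(u) + Ã(u)(w² ⊗ 1) + V_x)(W ⊗ 1)` is invertible THEN
`(W ⊗ 1)(1 − (V_W(u) + Ã(u)(w² ⊗ 1) + V_x)(W ⊗ 1))⁻¹ = (Δ_W(u) + L^{2k}·covAvgOp(u) − V_x)⁻¹` — the covariant Laplacian with defects PLUS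
THE COVARIANT MULTI-LEVEL AVERAGING FORM `η⁻²Σ_j levC_j[· ∼_j ·]T̃T`, minus the slot, inverted.
[cite: Balaban1985BackgroundPropagators, (3.60)–(3.64) p.402, (3.78) p.406; Balaban1984PropagatorsII, (2.13)–(2.14) p.225] -/
theorem covariantAvg_kernel_eq_multiLevel (hMh : 1 ≤ Mh) (hP : ∀ μ, 1 ≤ P μ) (D : TDomains d ℓ Mh k P R) {a : ℕ → ℝ}
    (ha : ∀ j, 1 ≤ j → 0 < a j) (Wp Wm : Fin (d + 1) → E → ↥(boxDom (N0 ℓ Mh k P)) → Matrix F F ℂ)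
    (Tg Tgi : E → ↥(boxDom (N0 ℓ Mh k P)) → Matrix F F ℂ)
    (Vx : Matrix (↥(boxDom (N0 ℓ Mh k P)) × F) (↥(boxDom (N0 ℓ Mh k P)) × F) ℂ) (u : E)
    (hunit : IsUnit (1 - (covShift ↥(boxDom (N0 ℓ Mh k P)) F (fun ν => tshift (N0 ℓ Mh k P) (unitVec ν)) ((((ℓ : ℝ) + 1) ^ k)⁻¹)
        Wp Wm u + avCorr D a Tg Tgi u * wOp ↥(boxDom (N0 ℓ Mh k P)) F (fun x => levW D x ^ 2) + Vx) *
        Matrix.blockDiagonal (fun _ : F =>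
          ((((ℓ : ℂ) + 1) ^ (2 * k))⁻¹ : ℂ) • (gmlT (N0 ℓ Mh k P) ℓ k D.lev a).map ((↑) : ℝ → ℂ))).det) :
    Matrix.blockDiagonal (fun _ : F => ((((ℓ : ℂ) + 1) ^ (2 * k))⁻¹ : ℂ) • (gmlT (N0 ℓ Mh k P) ℓ k D.lev a).map ((↑) : ℝ → ℂ)) *
        (1 - (covShift ↥(boxDom (N0 ℓ Mh k P)) F (fun ν => tshift (N0 ℓ Mh k P) (unitVec ν)) ((((ℓ : ℝ) + 1) ^ k)⁻¹) Wp Wm u +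
              avCorr D a Tg Tgi u * wOp ↥(boxDom (N0 ℓ Mh k P)) F (fun x => levW D x ^ 2) + Vx) *
          Matrix.blockDiagonal (fun _ : F =>
            ((((ℓ : ℂ) + 1) ^ (2 * k))⁻¹ : ℂ) • (gmlT (N0 ℓ Mh k P) ℓ k D.lev a).map ((↑) : ℝ → ℂ)))⁻¹ =
      (covLap ↥(boxDom (N0 ℓ Mh k P)) F (fun ν => tshift (N0 ℓ Mh k P) (unitVec ν)) ((((ℓ : ℝ) + 1) ^ k)⁻¹) Wp Wm u +
        (((ℓ : ℂ) + 1) ^ (2 * k) : ℂ) • covAvgOp D a Tg Tgi u - Vx)⁻¹ := by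
  have hunit' : IsUnit (1 - (covShift ↥(boxDom (N0 ℓ Mh k P)) F (fun ν => tshift (N0 ℓ Mh k P) (unitVec ν))
      ((((ℓ : ℝ) + 1) ^ k)⁻¹) Wp Wm u + (avCorr D a Tg Tgi u * wOp ↥(boxDom (N0 ℓ Mh k P)) F (fun x => levW D x ^ 2) + Vx)) *
        Matrix.blockDiagonal (fun _ : F =>
          ((((ℓ : ℂ) + 1) ^ (2 * k))⁻¹ : ℂ) • (gmlT (N0 ℓ Mh k P) ℓ k D.lev a).map ((↑) : ℝ → ℂ))).det := by
    rwa [← add_assoc]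
  rw [show covShift ↥(boxDom (N0 ℓ Mh k P)) F (fun ν => tshift (N0 ℓ Mh k P) (unitVec ν)) ((((ℓ : ℝ) + 1) ^ k)⁻¹) Wp Wm u +
        avCorr D a Tg Tgi u * wOp ↥(boxDom (N0 ℓ Mh k P)) F (fun x => levW D x ^ 2) + Vx =
      covShift ↥(boxDom (N0 ℓ Mh k P)) F (fun ν => tshift (N0 ℓ Mh k P) (unitVec ν)) ((((ℓ : ℝ) + 1) ^ k)⁻¹) Wp Wm u +
        (avCorr D a Tg Tgi u * wOp ↥(boxDom (N0 ℓ Mh k P)) F (fun x => levW D x ^ 2) + Vx) from add_assoc _ _ _,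
    covariant_kernel_eq_multiLevel hMh hP D ha Wp Wm _ u hunit', avCorr_mul_wOp]
  congr 1
  abel

end Kernel

end Summit.QuantumFields.BalabanUV.Gaps.D4WalkBlockCovariantAveragingMultiLevel

end
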